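import Mathlib
import Summits.SmoothPoincare4.SmoothPoincare4.Theorems.CylinderEntropyCylinderRungTwoKCertSoundTab
import HarnessLib

/-!
# Kernel certificate checker for `stub_certMid`, VI-a: the table specification

Infrastructure file for the kernel-clean discharge of the registered stub `stub_certMid` of crux stmt-SmoothPoincare4-7631
(`Summit.SmoothPoincare4.SmoothPoincare4.Theses.CylinderEntropy.CylinderRungTwo`, line `killing-flux`).  The semantic
specification `TabOK C a tab` of an atom's table along the θ-grid (values, slopes, grid-cell lower bounds, `e^{f(θ_i)}` upper
bounds), the grid angles `KCell.th`, the exponential form of the tangent minorant, and `atomsOK_forall`.  (That the COMPUTED tables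
meet the specification is `…KCertSoundTabE`.)  No named facts.
-/

-- the registered namespace `Summit.SmoothPoincare4.SmoothPoincare4.…` repeats a component
set_option linter.dupNamespace false

noncomputable section

namespace Summit.SmoothPoincare4.SmoothPoincare4.Cruxes.CylinderRungTwo.KillingFlux

namespace KCert

open Set
open Summit.SmoothPoincare4.SmoothPoincare4.Theorems.CylinderEntropySliceIsolation
open Summit.SmoothPoincare4.SmoothPoincare4.Theorems.CylinderEntropySliceIsolation.Cert

variable (C : KCell)

/-- The grid angle `θ_i`. [folklore] -/
def KCell.th (C : KCell) (i : ℕ) : ℝ := (C.grid.getD i gridD).theta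

/-- **Semantic specification of an atom's table**: one entry per grid point; at every index `i < N` the entry brackets
`Zc θ_i` (`0 ≤ zlo`), brackets `f'(θ_i)` (`0 ≤ mlo`), bounds `Zc` from below on the grid cell `[θ_i, θ_{i+1}]` (`0 ≤ cello`),
and bounds `e^{f(θ_i)}` from above. [folklore] -/
def TabOK (a : KAtom) (tab : List TabE) : Prop :=
  tab.length = C.grid.length ∧
  ∀ i, i < C.grid.length →
    0 ≤ (tab.getD i tabD).zlo ∧ (((tab.getD i tabD).zlo : ℚ) : ℝ) ≤ a.Zc (C.th i) ∧ a.Zc (C.th i) ≤ (((tab.getD i tabD).zhi : ℚ) : ℝ) ∧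
    0 ≤ (tab.getD i tabD).mlo ∧ (((tab.getD i tabD).mlo : ℚ) : ℝ) ≤ a.fd (C.th i) ∧ a.fd (C.th i) ≤ (((tab.getD i tabD).mhi : ℚ) : ℝ) ∧
    0 ≤ (tab.getD i tabD).cello ∧
    (i + 1 < C.grid.length → ∀ θ, C.th i ≤ θ → θ ≤ C.th (i + 1) → (((tab.getD i tabD).cello : ℚ) : ℝ) ≤ a.Zc θ) ∧
    Real.exp (a.f (C.th i)) ≤ (((tab.getD i tabD).expf : ℚ) : ℝ)

/-- The tangent-form lower bound in exponential form: for `θ₀ ≤ θ`, `0 ≤ m ≤ f'(θ₀)`, `z₀ ≤ Zc θ₀` with `0 < z₀`, and any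
real `B ≤ m (θ - θ₀) - (θ² - θ₀²)/(4τ)`: `z₀ e^B ≤ Zc θ`. [folklore] -/
theorem Zc_ge_tangent {a : KAtom} (ha : atomOK C a = true) {θ₀ θ m z₀ B : ℝ} (hle : θ₀ ≤ θ) (hm : m ≤ a.fd θ₀)
    (hz₀ : 0 < z₀) (hz : z₀ ≤ a.Zc θ₀) (hB : B ≤ m * (θ - θ₀) - (θ ^ 2 - θ₀ ^ 2) / (4 * a.tau)) :
    z₀ * Real.exp B ≤ a.Zc θ := by
  have ht := log_Zc_tangent C ha hle hm
  have h1 : Real.log z₀ ≤ Real.log (a.Zc θ₀) := Real.log_le_log hz₀ hz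
  have h2 : Real.log (z₀ * Real.exp B) ≤ Real.log (a.Zc θ) := by
    rw [Real.log_mul hz₀.ne' (Real.exp_pos _).ne', Real.log_exp]; linarith
  exact (Real.log_le_log_iff (by positivity) (Zc_pos C ha θ)).1 h2

/-- `atomsOK` gives `atomOK` for every listed atom. [folklore] -/
theorem atomsOK_forall {l : List KAtom} (h : atomsOK C l = true) : ∀ a ∈ l, atomOK C a = true := by
  induction l with
  | nil => simp
  | cons b l ih =>
    simp only [atomsOK, Bool.and_eq_true] at h
    intro a ha
    rcases List.mem_cons.1 ha with rfl | h'
    · exact h.1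
    · exact ih h.2 a h'

end KCert

/-- Registered sub-goal marker `stub_certMid_part17` of crux stmt-SmoothPoincare4-7631 (helper file 6-a of the kernel-clean
`stub_certMid`, line killing-flux): the tangent minorant of the zonal factor in exponential form. [folklore] -/
theorem stub_certMid_part17 : ∀ (C : KCert.KCell) (a : KCert.KAtom), KCert.atomOK C a = true →
    ∀ θ₀ θ m z₀ B : ℝ, θ₀ ≤ θ → m ≤ a.fd θ₀ → 0 < z₀ → z₀ ≤ a.Zc θ₀ →
      B ≤ m * (θ - θ₀) - (θ ^ 2 - θ₀ ^ 2) / (4 * a.tau) → z₀ * Real.exp B ≤ a.Zc θ :=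
  fun C _ ha _ _ _ _ _ h1 h2 h3 h4 h5 => KCert.Zc_ge_tangent C ha h1 h2 h3 h4 h5

end Summit.SmoothPoincare4.SmoothPoincare4.Cruxes.CylinderRungTwo.KillingFlux

end
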